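import Summits.CriticalPhenomena.CardyFormulaZ2.Theorems.CardyBondTriangularDiscretisationBridge
import Literature.Probability.Percolation.IsoradialRectangularCrossingsProofs

/-!
# F3 / BC5 witness: the rung `IsoRectAnchorBridgeAt α` at the floor's parameter `α = π/2`
is the proved floor `DiscretisationBridge_skeleton` (seed g1-CriticalPhenomena-0787).
-/

namespace Summit.CriticalPhenomena.CardyFormulaZ2.Cruxes.TriangularToSquareTransport.IsoRectRung

/-- Copy of the Sketch decl (verbatim). -/
def IsoRectAnchorBridgeAt (α : ℝ) : Prop :=
  (∀ R : Literature.Probability.RandomPlanarGeometry.ConformalRectangle,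
      R.HasCrossingLimit
        (fun δ ↦ (Literature.Probability.LatticeModels.prodBernoulli
            (Literature.Probability.Percolation.isoRectCriticalProb α)).real
          (Literature.Probability.Percolation.embDomainCrossing
            (Literature.Probability.Percolation.isoRectEmbedding α) R.carrier δ (R.arc 0) (R.arc 2)))
        Literature.Probability.RandomPlanarGeometry.cardyFunction) →
    ∀ R : Literature.Probability.RandomPlanarGeometry.ConformalRectangle,
      R.HasCrossingLimit (Literature.Probability.Percolation.bondDomainCrossingProb R)
        Literature.Probability.RandomPlanarGeometry.cardyFunction

/-- `𝕃(π/2)` in axis-parallel position is `squareLatticeEmbedding` as a function. -/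
theorem isoRectEmbedding_pi_div_two_eq :
    Literature.Probability.Percolation.isoRectEmbedding (Real.pi / 2) =
      Literature.Probability.LatticeModels.squareLatticeEmbedding.z :=
  funext Literature.Probability.Percolation.isoRectEmbedding_pi_div_two

/-- **Witness (F3).** The rung at `α = π/2` is the floor. -/
example : IsoRectAnchorBridgeAt (Real.pi / 2) := by
  intro h R
  refine Summit.CriticalPhenomena.CardyFormulaZ2.Cruxes.DiscretisationBridge.Birth.DiscretisationBridge_skeleton R ?_
  simpa only [isoRectEmbedding_pi_div_two_eq,
    Literature.Probability.Percolation.prodBernoulli_isoRectCriticalProb_pi_div_two] using h R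

/-- Named form of the witness (for `witness=` / tribunal `--witness`). -/
theorem IsoRectAnchorBridgeAt_pi_div_two : IsoRectAnchorBridgeAt (Real.pi / 2) := by
  intro h R
  refine Summit.CriticalPhenomena.CardyFormulaZ2.Cruxes.DiscretisationBridge.Birth.DiscretisationBridge_skeleton R ?_
  simpa only [isoRectEmbedding_pi_div_two_eq,
    Literature.Probability.Percolation.prodBernoulli_isoRectCriticalProb_pi_div_two] using h R

end Summit.CriticalPhenomena.CardyFormulaZ2.Cruxes.TriangularToSquareTransport.IsoRectRung
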